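import Literature.Geometry.Riemannian.ExpMapIndexForm
import Literature.Geometry.Riemannian.ExpMapInjectivity
import HarnessLib

/-!
# Lee 2018, Thm. 10.34 (b),(c): discharge of `lee_expMap_injectivityDomain`

Final assembly of the programme for the named fact
`Literature.Geometry.Riemannian.lee_expMap_injectivityDomain` (`ExponentialMap.lean`; J. M. Lee,
*Introduction to Riemannian Manifolds*, 2nd ed. (2018), Thm. 10.34: for a complete connected
Riemannian manifold and `p ∈ M`, (b) `exp_p|_{ID(p)}` is a diffeomorphism onto its image and
`exp_p(closure ID(p)) = M`, (c) `exp_p(ID(p)) = M ∖ Cut(p)`):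

* parts (1)–(4) — `exp_p(closure ID(p)) = M`, injectivity on `ID(p)`, `exp_p(ID(p)) = M ∖ Cut(p)`,
  smoothness on `ID(p)` — are `lee_expMap_injectivityDomain_parts` (`ExpMapInjectivity.lean`,
  Hopf–Rinow, normal neighbourhoods, Gauss lemma, corner cutting, Prop. 10.32);
* part (5) — the differential `d(exp_p)_v` is bijective for `v ∈ ID(p)` — is
  `mfderiv_riemannianExpMap_injective_of_mem_injectivityDomain` (`ExpMapIndexForm.lean`,
  Thm. 10.26 + Prop. 10.20 through the Jacobi field of the exponential variation, the energy
  second variation and the index form) combined with rank–nullity on `T_pM ≅ E`.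

No definitions, no new named facts (D-0026); net debt `-1`.

## References

* J. M. Lee, *Introduction to Riemannian Manifolds*, 2nd ed. (2018), Thm. 10.34, Thm. 10.26,
  Prop. 10.20, Prop. 10.32, Thm. 6.19 (Hopf–Rinow). [LeeRiemannianManifolds2018]
-/

noncomputable section

open Bundle Set Filter Function
open scoped Manifold ContDiff Topology

namespace Literature.Geometry.Riemannian

open Literature.Geometry.Lorentzian
open Literature.Geometry.Lorentzian.PseudoRiemannianMetric

/-- **Rank–nullity**: an injective continuous linear endomorphism of a finite-dimensional space
is bijective (Mathlib's `LinearMap.surjective_of_injective`). [folklore] -/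
theorem bijective_of_injective_continuousLinearMap {F : Type*} [AddCommGroup F] [Module ℝ F]
    [TopologicalSpace F] [FiniteDimensional ℝ F] {L : F →L[ℝ] F} (h : Injective L) :
    Bijective L :=
  ⟨h, LinearMap.surjective_of_injective (f := (L : F →ₗ[ℝ] F)) h⟩

/-- **Lee 2018, Thm. 10.34 (b),(c)** — discharge of the named fact
`lee_expMap_injectivityDomain`: for a smooth (`∞ ≤ n`) connected Riemannian manifold whose
Levi-Civita connection is geodesically complete and `p ∈ M`,
`exp_p(closure ID(p)) = M`, `exp_p` is injective on `ID(p)`, `exp_p(ID(p)) = M ∖ Cut(p)`, `exp_p`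
is `C^∞` on `ID(p)` and has bijective differential at every point of `ID(p)` (so that
`exp_p|_{ID(p)}` is a diffeomorphism onto `M ∖ Cut(p)`). Assembled from
`lee_expMap_injectivityDomain_parts` and `mfderiv_riemannianExpMap_injective_of_mem_injectivityDomain`.
[cite: LeeRiemannianManifolds2018, Thm. 10.34 (b),(c)] -/
theorem lee_expMap_injectivityDomain_holds : lee_expMap_injectivityDomain := by
  intro E _ _ _ _ H _ I M _ _ _ _ _ _ n hn g _ _ hg hc p
  have parts := lee_expMap_injectivityDomain_parts g hn hg hc p
  refine ⟨parts.1, parts.2.1, parts.2.2.1, parts.2.2.2, fun v hv ↦ ?_⟩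
  have hinj := mfderiv_riemannianExpMap_injective_of_mem_injectivityDomain g hn hg hc p hv
  haveI : FiniteDimensional ℝ (TangentSpace 𝓘(ℝ, E) (show E from v)) :=
    inferInstanceAs (FiniteDimensional ℝ E)
  exact bijective_of_injective_continuousLinearMap hinj

end Literature.Geometry.Riemannian

end
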